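import Mathlib
import Summits.Ventures.HodgeRepro2.T5HeckeBasisCells

/-!
# Non-vacuity of the cell basis: `H(O(antidiag(1,1,1))(ℚ_p), K)` has the basis `{T_k}_{k ∈ ℕ}`

Blind cell `pub-hodge-repro2`, seat p8 (gen 13), Tier-5 kernel support.  The hypotheses of
`T5HeckeBasisCells.heckeBasisCells` are jointly satisfiable: over `ℤ_p ⊂ ℚ_p` with the trivial
involution (`starRingOfComm`), `u = 1` and `ϖ = p` — the witness of
`T5UnitaryThreeHecke.isCartanDecomposition_three_padic` — the spherical Hecke algebra of the
orthogonal group `O(antidiag(1,1,1))(ℚ_p)` with respect to its integral points has the basis of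
cell operators `T_k`, `k ∈ ℕ` (`heckeBasisCells_padic`, `heckeBasisCells_padic_apply`).  (The
witness is for the SHAPE of the hypotheses; the record's inert places carry the Galois involution.)

README §8(d): uses an L-value-free non-vanishing device: NO.
-/

namespace Summit.Ventures.HodgeRepro2.T5HeckeBasisCellsPadic

open IsLocalization T5HeckeBasisCells

variable (p : ℕ) [Fact p.Prime] (k : Type*) [Field k]

/-- The residue field of `ℤ_p` is finite (the instance used by the `p`-adic witnesses). -/
theorem finite_residueField : Finite (IsLocalRing.ResidueField ℤ_[p]) := inferInstance

/-- **The cell basis for `O(antidiag(1,1,1))(ℚ_p)`**: the basis `{T_k}_{k ∈ ℕ}` of its spherical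
Hecke algebra with respect to `K = O ∩ GL₃(ℤ_p)`, with the trivial involution, `u = 1`, `ϖ = p`. -/
noncomputable def heckeBasisCells_padic :
    letI : StarRing ℚ_[p] := starRingOfComm
    Module.Basis ℕ k (T5HeckePermutationModule.heckeAlgebra k
      (T5UnitaryHeckeAdjoint.hyperspecialSubgroup ℤ_[p] (T5HermitianThreeElements.J3 (1 : ℚ_[p])))) :=
  letI : StarRing ℚ_[p] := starRingOfComm
  heckeBasisCells (R := ℤ_[p]) (E := ℚ_[p]) (fun _ hx => hx) (1 : ℚ_[p]) rfl one_ne_zero isInteger_one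
    (by rw [inv_one]; exact isInteger_one) PadicInt.irreducible_p rfl k

/-- The `i`-th basis vector is the cell operator of `diag(p^i, 1, p^{-i})`. -/
theorem heckeBasisCells_padic_apply (i : ℕ) :
    letI : StarRing ℚ_[p] := starRingOfComm
    heckeBasisCells_padic p k i =
      T5HeckeDoubleCoset.doubleCosetOp k
        (T5UnitaryHeckeAdjoint.hyperspecialSubgroup ℤ_[p] (T5HermitianThreeElements.J3 (1 : ℚ_[p])))
        (cellU (PadicInt.irreducible_p (p := p)) rfl (1 : ℚ_[p]) i) :=
  letI : StarRing ℚ_[p] := starRingOfComm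
  heckeBasisCells_apply (R := ℤ_[p]) (E := ℚ_[p]) (fun _ hx => hx) (1 : ℚ_[p]) rfl one_ne_zero
    isInteger_one (by rw [inv_one]; exact isInteger_one) PadicInt.irreducible_p rfl k i

end Summit.Ventures.HodgeRepro2.T5HeckeBasisCellsPadic
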